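import Summits.ValiantsHypothesis.ValiantsHypothesis.Theses.BarrierLever

/-!
# Route BarrierLever — the priority-peeling calculus DECIDES TT (item 19766, glue)

Item `stmt-ValiantsHypothesis-19766` `PriorityPeelingDecidesTransversal` (support, rank 9; planner p1-g11,
cell valiant-natproofs, rung V4, 𝒟-side door (c)):
`PairMoveSound → ColumnShearSound → PriorityPeelingCertificatesExist → TransversalMinorLayoutsNonsingular`.
The three PP statements (items 19759 / 19760 / 19761) are not yet rendered in the route file, so they are
spelled out VERBATIM (ledger signatures) as the hypotheses of `priorityPeelingDecidesTransversal`; the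
conclusion is the route decl `TransversalMinorLayoutsNonsingular` (item 19152, TT) by name.

**Proof.** Instantiate the predicate `P` of `PriorityPeelingCertificatesExist` with
`ALIVE nr nc r d ρ κ :⇔ ∃ G : Matrix (Fin nr) (Fin nc) ℂ, det (det G[ρ i, κ j])_{ij} ≠ 0` (MAP encoding:
rows `ρ i : Fin d → Fin nr`, columns `κ j : Fin d → Fin nc`). The closure clauses: (0) re-indexing — permuting
the slots of a row / column map multiplies the minor by a sign, permuting rows / columns of the outer matrix
multiplies its determinant by a sign, so the same `G` works (`alive_of_reindex`); (1) transposition —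
`G ↦ Gᵀ` transposes the outer matrix (`alive_of_transpose`); (2) base cases — `r = 0` (empty determinant),
`r = 1` and `d = 1` (the indicator matrix of the graph `{(ρ · a, κ · a)}` gives an identity minor / identity
outer matrix: `alive_one`, `alive_rank_one`), `r = 2` (`alive_two`, a GENERIC argument: with
`y ∈ range κ₁ ∖ range κ₀`, on the linear space of matrices whose column `y` vanishes on `range ρ₀` the
entry `X₀₁` vanishes identically while `X₀₀` and `X₁₁` are nonzero polynomial functions — permutation
witnesses, the second using `a₁` with `ρ₁ a₁ ∉ range ρ₀` — so `MvPolynomial.funext` yields a common good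
point); (3) the pair move and (4) the column shear are the two hypotheses verbatim. The conclusion of
`PriorityPeelingCertificatesExist` at `P := ALIVE` is TT's witness verbatim.

WHAT THIS IS NOT: glue only — TT (item 19152), hence TNS / item 19717, is reduced to the pair-move and shear
soundness items (19759, 19760; elementary) and the COMBINATORIAL conjecture 19761 (PP certificates exist; open,
0 known exceptions through gen 7's censuses). Nothing here on crux stmt-ValiantsHypothesis-14610 or on VP vs VNP.
-/

-- layout Summits/ValiantsHypothesis/ValiantsHypothesis forces the duplicated namespace component
set_option linter.dupNamespace false

namespace Summit.ValiantsHypothesis.ValiantsHypothesis.Theorems.BarrierLever.PPGlue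

open Matrix

/-! ## 1. Closure of ALIVE under re-indexing and transposition -/

/-- Permuting rows and columns of a square matrix by two permutations multiplies the determinant by
the two signs. -/
theorem det_submatrix_perm {n : Type*} [Fintype n] [DecidableEq n] {R : Type*} [CommRing R]
    (N : Matrix n n R) (α β : Equiv.Perm n) :
    (N.submatrix α β).det = (Equiv.Perm.sign α : R) * (Equiv.Perm.sign β : R) * N.det := by
  have h : N.submatrix α β = (N.submatrix α id).submatrix id β := by
    ext a b
    rfl
  rw [h, Matrix.det_permute', Matrix.det_permute]
  ring

/-- A unit of `ℤ` cast to `ℂ` is nonzero. -/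
theorem units_int_cast_ne_zero (u : ℤˣ) : ((u : ℤ) : ℂ) ≠ 0 := by
  rcases Int.units_eq_one_or u with h | h <;> simp [h]

/-- (0) RE-INDEXING: if the re-indexed configuration (outer rows by `σ`, outer columns by `τ`, slots of
row `i` by `α i`, slots of column `j` by `β j`) is alive, so is the original one — with the same `G`. -/
theorem alive_of_reindex {nr nc r d : ℕ} (ρ : Fin r → Fin d → Fin nr) (κ : Fin r → Fin d → Fin nc)
    (σ τ : Equiv.Perm (Fin r)) (α β : Fin r → Equiv.Perm (Fin d))
    (h : ∃ G : Matrix (Fin nr) (Fin nc) ℂ, (Matrix.of fun i j : Fin r =>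
      (G.submatrix (fun a => ρ (σ i) (α i a)) (fun c => κ (τ j) (β j c))).det).det ≠ 0) :
    ∃ G : Matrix (Fin nr) (Fin nc) ℂ,
      (Matrix.of fun i j : Fin r => (G.submatrix (ρ i) (κ j)).det).det ≠ 0 := by
  obtain ⟨G, hG⟩ := h
  refine ⟨G, fun h0 => hG ?_⟩
  set X : Matrix (Fin r) (Fin r) ℂ := Matrix.of fun i j : Fin r => (G.submatrix (ρ i) (κ j)).det
    with hX
  -- every re-indexed minor is a signed entry of `X.submatrix σ τ`
  have hentry : (Matrix.of fun i j : Fin r =>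
      (G.submatrix (fun a => ρ (σ i) (α i a)) (fun c => κ (τ j) (β j c))).det) =
      Matrix.of fun i j : Fin r => (Equiv.Perm.sign (α i) : ℂ) *
        ((Matrix.of fun i j : Fin r => (Equiv.Perm.sign (β j) : ℂ) * (X.submatrix σ τ) i j) i j) := by
    ext i j
    have hsub : G.submatrix (fun a => ρ (σ i) (α i a)) (fun c => κ (τ j) (β j c)) =
        (G.submatrix (ρ (σ i)) (κ (τ j))).submatrix (α i) (β j) := by
      ext a b
      rfl
    rw [Matrix.of_apply, Matrix.of_apply, Matrix.of_apply, hsub, det_submatrix_perm,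
      Matrix.submatrix_apply, hX, Matrix.of_apply]
    ring
  rw [hentry, Matrix.det_mul_column, Matrix.det_mul_row, det_submatrix_perm, h0]
  ring

/-- (1) TRANSPOSITION: if the transposed configuration is alive, so is the original one (`G ↦ Gᵀ`). -/
theorem alive_of_transpose {nr nc r d : ℕ} (ρ : Fin r → Fin d → Fin nr) (κ : Fin r → Fin d → Fin nc)
    (h : ∃ G : Matrix (Fin nc) (Fin nr) ℂ,
      (Matrix.of fun i j : Fin r => (G.submatrix (κ i) (ρ j)).det).det ≠ 0) :
    ∃ G : Matrix (Fin nr) (Fin nc) ℂ,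
      (Matrix.of fun i j : Fin r => (G.submatrix (ρ i) (κ j)).det).det ≠ 0 := by
  obtain ⟨G, hG⟩ := h
  refine ⟨G.transpose, ?_⟩
  have hT : (Matrix.of fun i j : Fin r => (G.transpose.submatrix (ρ i) (κ j)).det) =
      (Matrix.of fun i j : Fin r => (G.submatrix (κ i) (ρ j)).det).transpose := by
    ext i j
    rw [Matrix.of_apply, Matrix.transpose_apply, Matrix.of_apply, ← Matrix.transpose_submatrix,
      Matrix.det_transpose]
  rwa [hT, Matrix.det_transpose]

/-! ## 2. Base cases -/

/-- (2a) `r = 0`: the empty outer determinant is `1`. -/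
theorem alive_zero {nr nc d : ℕ} (ρ : Fin 0 → Fin d → Fin nr) (κ : Fin 0 → Fin d → Fin nc) :
    ∃ G : Matrix (Fin nr) (Fin nc) ℂ,
      (Matrix.of fun i j : Fin 0 => (G.submatrix (ρ i) (κ j)).det).det ≠ 0 :=
  ⟨0, by rw [Matrix.det_isEmpty]; exact one_ne_zero⟩

/-- (2b) `r = 1` with an injective row map and an injective column map: the indicator matrix of the
graph `{(ρ 0 a, κ 0 a)}` has the identity as its minor. -/
theorem alive_one {nr nc d : ℕ} (ρ : Fin 1 → Fin d → Fin nr) (κ : Fin 1 → Fin d → Fin nc)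
    (hρ : Function.Injective (ρ 0)) (hκ : Function.Injective (κ 0)) :
    ∃ G : Matrix (Fin nr) (Fin nc) ℂ,
      (Matrix.of fun i j : Fin 1 => (G.submatrix (ρ i) (κ j)).det).det ≠ 0 := by
  classical
  refine ⟨Matrix.of fun p q => if ∃ a, ρ 0 a = p ∧ κ 0 a = q then 1 else 0, ?_⟩
  have h1 : (Matrix.of fun p q => if ∃ a, ρ 0 a = p ∧ κ 0 a = q then (1 : ℂ) else 0).submatrix
      (ρ 0) (κ 0) = 1 := by
    ext a b
    simp only [Matrix.submatrix_apply, Matrix.of_apply, Matrix.one_apply]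
    have hiff : (∃ a', ρ 0 a' = ρ 0 a ∧ κ 0 a' = κ 0 b) ↔ a = b := by
      constructor
      · rintro ⟨a', h1, h2⟩
        exact (hρ h1).symm.trans (hκ h2)
      · rintro rfl
        exact ⟨a, rfl, rfl⟩
    rw [if_congr hiff rfl rfl]
  rw [Matrix.det_fin_one, Matrix.of_apply, h1, Matrix.det_one]
  exact one_ne_zero

/-- (2c) `d = 1` with distinct single row literals and distinct single column literals: the indicator
matrix of the graph `{(ρ i 0, κ i 0)}` has the identity as its outer matrix. -/
theorem alive_rank_one {nr nc r : ℕ} (ρ : Fin r → Fin 1 → Fin nr) (κ : Fin r → Fin 1 → Fin nc)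
    (hρ : Function.Injective (fun i => ρ i 0)) (hκ : Function.Injective (fun j => κ j 0)) :
    ∃ G : Matrix (Fin nr) (Fin nc) ℂ,
      (Matrix.of fun i j : Fin r => (G.submatrix (ρ i) (κ j)).det).det ≠ 0 := by
  classical
  refine ⟨Matrix.of fun p q => if ∃ i, ρ i 0 = p ∧ κ i 0 = q then 1 else 0, ?_⟩
  have h1 : (Matrix.of fun i j : Fin r => ((Matrix.of fun p q =>
      if ∃ i, ρ i 0 = p ∧ κ i 0 = q then (1 : ℂ) else 0).submatrix (ρ i) (κ j)).det) = 1 := by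
    ext i j
    rw [Matrix.of_apply, Matrix.det_fin_one]
    simp only [Matrix.submatrix_apply, Matrix.of_apply, Matrix.one_apply]
    have hiff : (∃ i', ρ i' 0 = ρ i 0 ∧ κ i' 0 = κ j 0) ↔ i = j := by
      constructor
      · rintro ⟨i', h1, h2⟩
        exact (hρ h1).symm.trans (hκ h2)
      · rintro rfl
        exact ⟨i, rfl, rfl⟩
    rw [if_congr hiff rfl rfl]
  rw [h1, Matrix.det_one]
  exact one_ne_zero

/-! ## 3. The base case `r = 2` (generic argument) -/

/-- Two maps `Fin d → Fin n`, the second injective, with different ranges: some value of the second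
lies outside the range of the first. -/
theorem exists_not_mem_range {d n : ℕ} (f g : Fin d → Fin n)
    (hg : Function.Injective g) (hne : Set.range f ≠ Set.range g) : ∃ c, g c ∉ Set.range f := by
  by_contra hcon
  push Not at hcon
  apply hne
  -- `g` factors through `f` by an injective, hence surjective, self-map of `Fin d`
  choose e he using hcon
  have heinj : Function.Injective e := fun c c' h => hg (by rw [← he c, ← he c', h])
  have hesurj : Function.Surjective e := Finite.surjective_of_injective heinj
  ext p
  constructor
  · rintro ⟨a, rfl⟩
    obtain ⟨c, hc⟩ := hesurj a
    exact ⟨c, by rw [← he c, hc]⟩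
  · rintro ⟨c, rfl⟩
    exact ⟨e c, he c⟩

/-- Layout determinants commute with ring homomorphisms applied entrywise (rectangular version). -/
theorem map_layoutDet {R S : Type*} [CommRing R] [CommRing S] (f : R →+* S) {r d nr nc : ℕ}
    (M : Matrix (Fin nr) (Fin nc) R) (ρ : Fin r → Fin d → Fin nr) (κ : Fin r → Fin d → Fin nc) :
    f (Matrix.of fun i j : Fin r => (M.submatrix (ρ i) (κ j)).det).det =
      (Matrix.of fun i j : Fin r => ((M.map f).submatrix (ρ i) (κ j)).det).det := by
  rw [RingHom.map_det]
  congr 1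
  ext i j
  rw [RingHom.mapMatrix_apply, Matrix.map_apply, Matrix.of_apply, Matrix.of_apply, RingHom.map_det,
    RingHom.mapMatrix_apply, Matrix.submatrix_map]

/-- A nonzero complex polynomial in finitely many variables has a non-root. -/
theorem exists_eval_ne_zero {ι : Type*} [Fintype ι] (P : MvPolynomial ι ℂ) (hP : P ≠ 0) :
    ∃ g : ι → ℂ, MvPolynomial.eval g P ≠ 0 := by
  by_contra hcon
  push Not at hcon
  exact hP (MvPolynomial.funext (fun g => by rw [hcon g, map_zero]))

/-- (2d) `r = 2` with injective row / column maps and distinct ranges on both sides. -/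
theorem alive_two {nr nc d : ℕ} (ρ : Fin 2 → Fin d → Fin nr) (κ : Fin 2 → Fin d → Fin nc)
    (hρ0 : Function.Injective (ρ 0)) (hρ1 : Function.Injective (ρ 1))
    (hκ0 : Function.Injective (κ 0)) (hκ1 : Function.Injective (κ 1))
    (hρ : Set.range (ρ 0) ≠ Set.range (ρ 1)) (hκ : Set.range (κ 0) ≠ Set.range (κ 1)) :
    ∃ G : Matrix (Fin nr) (Fin nc) ℂ,
      (Matrix.of fun i j : Fin 2 => (G.submatrix (ρ i) (κ j)).det).det ≠ 0 := by
  classical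
  obtain ⟨cy, hcy⟩ := exists_not_mem_range (κ 0) (κ 1) hκ1 hκ
  obtain ⟨a₁, ha₁⟩ := exists_not_mem_range (ρ 0) (ρ 1) hρ1 hρ
  -- the constrained substitution: column `κ 1 cy` vanishes on the range of `ρ 0`
  let Φ : (Fin nr × Fin nc → ℂ) → Matrix (Fin nr) (Fin nc) ℂ := fun g =>
    Matrix.of fun p q => if q = κ 1 cy ∧ p ∈ Set.range (ρ 0) then 0 else g (p, q)
  -- the constrained generic matrix
  let Xs : Matrix (Fin nr) (Fin nc) (MvPolynomial (Fin nr × Fin nc) ℂ) :=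
    Matrix.of fun p q => if q = κ 1 cy ∧ p ∈ Set.range (ρ 0) then 0 else MvPolynomial.X (p, q)
  have hev : ∀ g : Fin nr × Fin nc → ℂ, Xs.map (MvPolynomial.eval g) = Φ g := by
    intro g
    ext p q
    simp only [Xs, Φ, Matrix.map_apply, Matrix.of_apply]
    split_ifs with hc
    · rw [map_zero]
    · rw [MvPolynomial.eval_X]
  -- the two diagonal entries as polynomials
  let P₀ : MvPolynomial (Fin nr × Fin nc) ℂ := (Xs.submatrix (ρ 0) (κ 0)).det
  let P₁ : MvPolynomial (Fin nr × Fin nc) ℂ := (Xs.submatrix (ρ 1) (κ 1)).det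
  have hP₀ev : ∀ g, MvPolynomial.eval g P₀ = ((Φ g).submatrix (ρ 0) (κ 0)).det := by
    intro g
    rw [RingHom.map_det, RingHom.mapMatrix_apply, ← Matrix.submatrix_map, hev]
  have hP₁ev : ∀ g, MvPolynomial.eval g P₁ = ((Φ g).submatrix (ρ 1) (κ 1)).det := by
    intro g
    rw [RingHom.map_det, RingHom.mapMatrix_apply, ← Matrix.submatrix_map, hev]
  -- the off-diagonal entry `X₀₁` vanishes identically (zero column `cy`)
  have hXs : ∀ p q, Xs p q = if q = κ 1 cy ∧ p ∈ Set.range (ρ 0) then 0 else MvPolynomial.X (p, q) :=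
    fun p q => rfl
  have hX01 : (Xs.submatrix (ρ 0) (κ 1)).det = 0 := by
    refine Matrix.det_eq_zero_of_column_eq_zero cy (fun a => ?_)
    rw [Matrix.submatrix_apply, hXs, if_pos ⟨rfl, a, rfl⟩]
  -- hence the outer determinant of the generic matrix is `P₀ * P₁`
  have hdet : (Matrix.of fun i j : Fin 2 => (Xs.submatrix (ρ i) (κ j)).det).det = P₀ * P₁ := by
    rw [Matrix.det_fin_two]
    simp only [Matrix.of_apply]
    rw [hX01, zero_mul, sub_zero]
  -- `P₀ ≠ 0`: witness the indicator of the graph of `(ρ 0, κ 0)`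
  have hP₀ : P₀ ≠ 0 := by
    intro h0
    have h1 := hP₀ev (fun s => if ∃ a, ρ 0 a = s.1 ∧ κ 0 a = s.2 then 1 else 0)
    rw [h0, map_zero] at h1
    apply one_ne_zero (α := ℂ)
    rw [← Matrix.det_one (n := Fin d) (R := ℂ), h1]
    congr 1
    ext a b
    simp only [Φ, Matrix.submatrix_apply, Matrix.of_apply, Matrix.one_apply]
    have hne : ¬ (κ 0 b = κ 1 cy ∧ ρ 0 a ∈ Set.range (ρ 0)) := fun hc => hcy ⟨b, hc.1⟩
    rw [if_neg hne]
    have hiff : (∃ a', ρ 0 a' = ρ 0 a ∧ κ 0 a' = κ 0 b) ↔ a = b := by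
      constructor
      · rintro ⟨a', h1, h2⟩
        exact (hρ0 h1).symm.trans (hκ0 h2)
      · rintro rfl
        exact ⟨a, rfl, rfl⟩
    rw [if_congr hiff rfl rfl]
  -- `P₁ ≠ 0`: witness the indicator of `{(ρ 1 (e c), κ 1 c)}`, `e := swap a₁ cy`
  have hP₁ : P₁ ≠ 0 := by
    intro h0
    have h1 := hP₁ev (fun s => if ∃ c, ρ 1 (Equiv.swap a₁ cy c) = s.1 ∧ κ 1 c = s.2 then 1 else 0)
    rw [h0, map_zero] at h1
    have hmat : (Φ (fun s => if ∃ c, ρ 1 (Equiv.swap a₁ cy c) = s.1 ∧ κ 1 c = s.2 then 1 else 0)).submatrix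
        (ρ 1) (κ 1) = (1 : Matrix (Fin d) (Fin d) ℂ).submatrix id (Equiv.swap a₁ cy) := by
      ext a c
      simp only [Φ, Matrix.submatrix_apply, Matrix.of_apply, Matrix.one_apply, id_eq]
      have hiff : (∃ c', ρ 1 (Equiv.swap a₁ cy c') = ρ 1 a ∧ κ 1 c' = κ 1 c) ↔ a = Equiv.swap a₁ cy c := by
        constructor
        · rintro ⟨c', h1, h2⟩
          rw [← hρ1 h1, hκ1 h2]
        · rintro h
          exact ⟨c, h.symm ▸ rfl, rfl⟩
      by_cases hc : κ 1 c = κ 1 cy ∧ ρ 1 a ∈ Set.range (ρ 0)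
      · -- forced zero: then `c = cy` and `a ≠ a₁ = e cy`
        have hccy : c = cy := hκ1 hc.1
        have hne : ¬ a = Equiv.swap a₁ cy c := by
          intro hae
          apply ha₁
          rw [hae, hccy, Equiv.swap_apply_right] at hc
          exact hc.2
        rw [if_pos hc, if_neg hne]
      · rw [if_neg hc]
        by_cases hac : a = Equiv.swap a₁ cy c
        · rw [if_pos (hiff.mpr hac), if_pos hac]
        · rw [if_neg (fun h' => hac (hiff.mp h')), if_neg hac]
    apply units_int_cast_ne_zero (Equiv.Perm.sign (Equiv.swap a₁ cy))
    have h2 : ((1 : Matrix (Fin d) (Fin d) ℂ).submatrix id (Equiv.swap a₁ cy)).det = 0 := by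
      rw [← hmat]
      exact h1.symm
    rw [Matrix.det_permute', Matrix.det_one, mul_one] at h2
    exact h2
  -- a common good point
  obtain ⟨g, hg⟩ := exists_eval_ne_zero (P₀ * P₁) (mul_ne_zero hP₀ hP₁)
  refine ⟨Φ g, ?_⟩
  rw [← hev g, ← map_layoutDet, hdet]
  exact hg

/-! ## 4. The glue -/

/-- **Item 19766 `PriorityPeelingDecidesTransversal`** (glue): `PairMoveSound → ColumnShearSound →
PriorityPeelingCertificatesExist → TransversalMinorLayoutsNonsingular`, the three hypotheses spelled out
verbatim (ledger signatures of items 19759, 19760, 19761 — not yet rendered as route decls), the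
conclusion the route decl of item 19152 (TT). Proof: instantiate the predicate with ALIVE; the closure
clauses are `alive_of_reindex`, `alive_of_transpose`, `alive_zero`, `alive_one`, `alive_rank_one`,
`alive_two` and the two hypotheses; the conclusion is TT's witness verbatim. -/
theorem priorityPeelingDecidesTransversal
    (PM : ∀ (nr nc k m d : ℕ) (ρ : Fin (k + m) → Fin (d + 1) → Fin nr)
      (κ : Fin (k + m) → Fin (d + 1) → Fin nc) (ℓ₀ ℓ₁ : Fin nr) (prio : Fin nc → ℕ)
      (T : Finset (Fin nc)), ℓ₀ ≠ ℓ₁ → (∀ i : Fin k, ρ (Fin.castAdd m i) 0 = ℓ₀) →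
      (∀ i : Fin m, ρ (Fin.natAdd k i) 0 = ℓ₁) →
      (∀ (i : Fin (k + m)) (a : Fin d), ρ i a.succ ≠ ℓ₀ ∧ ρ i a.succ ≠ ℓ₁) →
      (∀ (j : Fin (k + m)) (c : Fin d), prio (κ j c.succ) < prio (κ j 0)) →
      (∀ j : Fin k, κ (Fin.castAdd m j) 0 ∈ T) → (∀ j : Fin m, κ (Fin.natAdd k j) 0 ∉ T) →
      (∃ G : Matrix (Fin nr) (Fin nc) ℂ, (Matrix.of fun i j : Fin k => (G.submatrix
        (fun a : Fin d => ρ (Fin.castAdd m i) a.succ)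
        (fun c : Fin d => κ (Fin.castAdd m j) c.succ)).det).det ≠ 0) →
      (∃ G : Matrix (Fin nr) (Fin nc) ℂ, (Matrix.of fun i j : Fin m => (G.submatrix
        (fun a : Fin d => ρ (Fin.natAdd k i) a.succ)
        (fun c : Fin d => κ (Fin.natAdd k j) c.succ)).det).det ≠ 0) →
      ∃ G : Matrix (Fin nr) (Fin nc) ℂ,
        (Matrix.of fun i j : Fin (k + m) => (G.submatrix (ρ i) (κ j)).det).det ≠ 0)
    (CS : ∀ (nr nc r d : ℕ) (ρ : Fin r → Fin d → Fin nr) (κ : Fin r → Fin d → Fin nc) (x y : Fin nc),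
      x ≠ y → (∃ G : Matrix (Fin nr) (Fin nc) ℂ, (Matrix.of fun i j : Fin r => (G.submatrix (ρ i)
        (fun c : Fin d => if κ j c = x ∧ (∀ c' : Fin d, κ j c' ≠ y) then y else κ j c)).det).det
        ≠ 0) →
      ∃ G : Matrix (Fin nr) (Fin nc) ℂ,
        (Matrix.of fun i j : Fin r => (G.submatrix (ρ i) (κ j)).det).det ≠ 0)
    (PP : ∀ P : (nr nc r d : ℕ) → (Fin r → Fin d → Fin nr) → (Fin r → Fin d → Fin nc) → Prop,
      (∀ (nr nc r d : ℕ) (ρ : Fin r → Fin d → Fin nr) (κ : Fin r → Fin d → Fin nc)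
        (σ τ : Equiv.Perm (Fin r)) (α β : Fin r → Equiv.Perm (Fin d)),
        P nr nc r d (fun i a => ρ (σ i) (α i a)) (fun j c => κ (τ j) (β j c)) → P nr nc r d ρ κ) →
      (∀ (nr nc r d : ℕ) (ρ : Fin r → Fin d → Fin nr) (κ : Fin r → Fin d → Fin nc),
        P nc nr r d κ ρ → P nr nc r d ρ κ) →
      (∀ (nr nc d : ℕ) (ρ : Fin 0 → Fin d → Fin nr) (κ : Fin 0 → Fin d → Fin nc),
        P nr nc 0 d ρ κ) →
      (∀ (nr nc d : ℕ) (ρ : Fin 1 → Fin d → Fin nr) (κ : Fin 1 → Fin d → Fin nc),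
        Function.Injective (ρ 0) → Function.Injective (κ 0) → P nr nc 1 d ρ κ) →
      (∀ (nr nc r : ℕ) (ρ : Fin r → Fin 1 → Fin nr) (κ : Fin r → Fin 1 → Fin nc),
        Function.Injective (fun i => ρ i 0) → Function.Injective (fun j => κ j 0) →
        P nr nc r 1 ρ κ) →
      (∀ (nr nc d : ℕ) (ρ : Fin 2 → Fin d → Fin nr) (κ : Fin 2 → Fin d → Fin nc),
        Function.Injective (ρ 0) → Function.Injective (ρ 1) → Function.Injective (κ 0) →
        Function.Injective (κ 1) → Set.range (ρ 0) ≠ Set.range (ρ 1) →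
        Set.range (κ 0) ≠ Set.range (κ 1) → P nr nc 2 d ρ κ) →
      (∀ (nr nc k m d : ℕ) (ρ : Fin (k + m) → Fin (d + 1) → Fin nr)
        (κ : Fin (k + m) → Fin (d + 1) → Fin nc) (ℓ₀ ℓ₁ : Fin nr) (prio : Fin nc → ℕ)
        (T : Finset (Fin nc)), ℓ₀ ≠ ℓ₁ → (∀ i : Fin k, ρ (Fin.castAdd m i) 0 = ℓ₀) →
        (∀ i : Fin m, ρ (Fin.natAdd k i) 0 = ℓ₁) →
        (∀ (i : Fin (k + m)) (a : Fin d), ρ i a.succ ≠ ℓ₀ ∧ ρ i a.succ ≠ ℓ₁) →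
        (∀ (j : Fin (k + m)) (c : Fin d), prio (κ j c.succ) < prio (κ j 0)) →
        (∀ j : Fin k, κ (Fin.castAdd m j) 0 ∈ T) → (∀ j : Fin m, κ (Fin.natAdd k j) 0 ∉ T) →
        P nr nc k d (fun i a => ρ (Fin.castAdd m i) a.succ) (fun j c => κ (Fin.castAdd m j) c.succ) →
        P nr nc m d (fun i a => ρ (Fin.natAdd k i) a.succ) (fun j c => κ (Fin.natAdd k j) c.succ) →
        P nr nc (k + m) (d + 1) ρ κ) →
      (∀ (nr nc r d : ℕ) (ρ : Fin r → Fin d → Fin nr) (κ : Fin r → Fin d → Fin nc) (x y : Fin nc),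
        x ≠ y →
        P nr nc r d ρ (fun j c => if κ j c = x ∧ (∀ c' : Fin d, κ j c' ≠ y) then y else κ j c) →
        P nr nc r d ρ κ) →
      ∀ (h r : ℕ) (u w : Fin r → Finset (Fin h)), Function.Injective u → Function.Injective w →
        P (h + h) (h + h) r h (fun i a => if a ∈ u i then Fin.castAdd h a else Fin.natAdd h a)
          (fun j c => if c ∈ w j then Fin.natAdd h c else Fin.castAdd h c)) :
    Theses.BarrierLever.TransversalMinorLayoutsNonsingular := by
  intro h r u w hu hw
  exact PP (fun nr nc r d ρ κ => ∃ G : Matrix (Fin nr) (Fin nc) ℂ,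
      (Matrix.of fun i j : Fin r => (G.submatrix (ρ i) (κ j)).det).det ≠ 0)
    (fun nr nc r d ρ κ σ τ α β hre => alive_of_reindex ρ κ σ τ α β hre)
    (fun nr nc r d ρ κ htr => alive_of_transpose ρ κ htr)
    (fun nr nc d ρ κ => alive_zero ρ κ)
    (fun nr nc d ρ κ hρ hκ => alive_one ρ κ hρ hκ)
    (fun nr nc r ρ κ hρ hκ => alive_rank_one ρ κ hρ hκ)
    (fun nr nc d ρ κ h₁ h₂ h₃ h₄ h₅ h₆ => alive_two ρ κ h₁ h₂ h₃ h₄ h₅ h₆)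
    PM CS h r u w hu hw

/-- **Item 19766 by name.** `PriorityPeelingDecidesTransversal` (route file, rev 9) holds: its three
hypotheses `PairMoveSound`, `ColumnShearSound`, `PriorityPeelingCertificatesExist` and its conclusion
unfold to the statement of `priorityPeelingDecidesTransversal` verbatim. -/
theorem priorityPeelingDecidesTransversal_route :
    Theses.BarrierLever.PriorityPeelingDecidesTransversal :=
  fun PM CS PP => priorityPeelingDecidesTransversal PM CS PP

end Summit.ValiantsHypothesis.ValiantsHypothesis.Theorems.BarrierLever.PPGlue
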